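import Summits.Parity.GeneralizedHardyLittlewood.Theorems.PrimeLevelFamEdgeMomentsBeyondDiagonalDiagDecorWeightRungThree
import HarnessLib

/-!
# Route `PrimeLevelFamEdge`, crux K_A `MomentsBeyondDiagonal` (stmt-Parity-20007), line «petersson_layers» v4, stub `stub_diag`:
# **the EIGHTH central divisor-log moment on squarefree numbers: `M₈ = τ·(105P₂⁴ − 420P₂²P₄ + 448P₂P₆ + 140P₄² − 272P₈)`** —
# the new decoration of rung 4 (orders `(0,4)`-type need only `M₄`; `(2,4)`, `(4,4)` bring `M₆`, `M₈`) of the generic Hecke algebra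
# `…DiagDecorWeightGeneric` / `…DiagDecorOrderHecke.heckeSum_order_eq`

After `M₄ = τ(3P₂² − 2P₄)` (`…DiagDecorWeightRungTwo`) and `M₆ = τ(15P₂³ − 30P₂P₄ + 16P₆)` (`…DiagDecorWeightRungThree`), the
orders `(i,j)` with `i + j = 8` bring the eighth moment `M₈(k) = Σ_{d∣k}(2log d − log k)⁸`. On squarefree `k` (cumulants of the
generating function `τ(k)Π_{p∣k}cosh(t log p)`: `κ₂ = P₂`, `κ₄ = −2P₄`, `κ₆ = 16P₆`, `κ₈ = −272P₈`, `8!·[t⁸]`):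

* `centralMoment_seven` — `M₇ = 0`;
* `centralMoment_eight_of_squarefree` — **`M₈ = τ·(105P₂⁴ − 420P₂²P₄ + 448P₂P₆ + 140P₄² − 272P₈)`**, `P_m(k) = Σ_{p∣k}log^m p`.

Def-free; theorems only. Helper `--supports stmt-Parity-20007`; closes nothing; K_A, K_B and the Parity summit are NOT proved;
nothing about Landau–Siegel zeros.

## References
* E. Kowalski, P. Michel, J. VanderKam, J. reine angew. Math. 526 (2000), (21)–(28) pp. 12–15.
  [cite: KowalskiMichelVanderKam2000, (23)–(28) — derivation (Hecke-divisor bookkeeping of the order-(i,j) diagonal weight)]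
-/

noncomputable section

open scoped Real ArithmeticFunction.Moebius
open Finset ArithmeticFunction

namespace Summit.Parity.GeneralizedHardyLittlewood.Theorems.MomentsBeyondDiagonal.DiagKernel

/-- `M₇ = 0` (odd central moment). [folklore] -/
theorem centralMoment_seven (k : ℕ) : ∑ d ∈ k.divisors, (2 * Real.log d - Real.log k) ^ 7 = 0 :=
  centralMoment_eq_zero_of_odd (by decide) k

set_option maxHeartbeats 800000 in
-- one large `ring` normalisation in the coprime step
/-- **`M₈ = τ·(105P₂⁴ − 420P₂²P₄ + 448P₂P₆ + 140P₄² − 272P₈)` on squarefree numbers**: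
`Σ_{d∣k}(2log d − log k)⁸ = τ(k)·(105(Σlog²p)⁴ − 420(Σlog²p)²(Σlog⁴p) + 448(Σlog²p)(Σlog⁶p) + 140(Σlog⁴p)² − 272Σlog⁸p)` (sums over
`p ∣ k`) for squarefree `k` (eighth moment of a sum of independent signs). [folklore] -/
theorem centralMoment_eight_of_squarefree {k : ℕ} (hk : Squarefree k) :
    ∑ d ∈ k.divisors, (2 * Real.log d - Real.log k) ^ 8 =
      (k.divisors.card : ℝ) *
        (105 * (∑ p ∈ k.primeFactors, Real.log p ^ 2) ^ 4 -
          420 * (∑ p ∈ k.primeFactors, Real.log p ^ 2) ^ 2 * (∑ p ∈ k.primeFactors, Real.log p ^ 4) +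
          448 * (∑ p ∈ k.primeFactors, Real.log p ^ 2) * (∑ p ∈ k.primeFactors, Real.log p ^ 6) +
          140 * (∑ p ∈ k.primeFactors, Real.log p ^ 4) ^ 2 -
          272 * ∑ p ∈ k.primeFactors, Real.log p ^ 8) := by
  induction k using Nat.recOnPosPrimePosCoprime with
  | zero => exact absurd hk not_squarefree_zero
  | one => simp
  | prime_pow p n hp hn =>
    have hn1 : n = 1 := ((Nat.squarefree_pow_iff hp.ne_one hn.ne').1 hk).2
    subst hn1
    rw [pow_one, centralMoment_prime 8 hp, hp.divisors, Finset.card_pair hp.one_lt.ne, hp.primeFactors,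
      Finset.sum_singleton, Finset.sum_singleton, Finset.sum_singleton, Finset.sum_singleton]
    ring
  | coprime a b ha hb hab iha ihb =>
    have hsq := Nat.squarefree_mul_iff.1 hk
    have ha0 : a ≠ 0 := by omega
    have hb0 : b ≠ 0 := by omega
    have hmul := centralMoment_mul_of_coprime 8 ha0 hb0 hab
    push_cast at hmul ⊢
    rw [hmul]
    simp only [Finset.sum_range_succ, Finset.sum_range_zero, zero_add, Nat.sub_self, Nat.sub_zero,
      iha hsq.2.1, ihb hsq.2.2, centralMoment_one, centralMoment_zero, centralMoment_three, centralMoment_five,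
      centralMoment_seven,
      centralMoment_two_of_squarefree hsq.2.1, centralMoment_two_of_squarefree hsq.2.2,
      centralMoment_four_of_squarefree hsq.2.1, centralMoment_four_of_squarefree hsq.2.2,
      centralMoment_six_of_squarefree hsq.2.1, centralMoment_six_of_squarefree hsq.2.2]
    rw [Nat.Coprime.card_divisors_mul hab, Nat.Coprime.primeFactors_mul hab,
      Finset.sum_union (Nat.Coprime.disjoint_primeFactors hab),
      Finset.sum_union (Nat.Coprime.disjoint_primeFactors hab),
      Finset.sum_union (Nat.Coprime.disjoint_primeFactors hab),
      Finset.sum_union (Nat.Coprime.disjoint_primeFactors hab)]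
    push_cast
    norm_num [Nat.choose]
    ring

end Summit.Parity.GeneralizedHardyLittlewood.Theorems.MomentsBeyondDiagonal.DiagKernel

end
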